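import Literature.Geometry.Lorentzian.RiemannianMeasureDensity
import HarnessLib

/-!
# The Riemannian measure of a conformal metric: `dμ_{φ h} = φ^{m/2} dμ_h` (`= u⁴ dμ_h` for
# `φ = u²` in dimension four)

Companion of `Volume.lean` / `RiemannianMeasureDensity.lean` (topic `Geometry/Lorentzian`). For two
`C^n` Riemannian metrics `h₁, h₂` on a compact manifold `N` modelled on `ℝ^m` which are POINTWISE
CONFORMAL, `(h₁)_x = φ(x) (h₂)_x` with `φ > 0` measurable (the relation `IsConformalTo` of
`Riemannian/YamabeConstant.lean`, kept inline so that no definition is needed), the Riemannian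
measures (`riemannianMeasure`, the Euclidean-normalised top-dimensional Hausdorff measure of the
length metric, `= √det h_{ij} dy` in charts by `riemannianMeasure_eq_integral_sqrt_det_holds`)
satisfy

* `riemannianMeasure_eq_withDensity_of_conformal` — **`μ_{h₁} = √(φ^m) · μ_{h₂}`**, i.e.
  `dV_{φ h} = φ^{m/2} dV_h` (Chavel 2006, §III.3, (III.3.5): `dV = √g dx`, and
  `det(φ h_{ij}) = φ^m det(h_{ij})`; Lee–Parker 1987, §1 after (1.1): for `g̃ = φ^{4/(n−2)} g`,
  `dV_{g̃} = φ^{2n/(n−2)} dV_g`);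
* `riemannianMeasure_eq_withDensity_of_conformal_four` — in dimension `m = 4`:
  **`μ_{φ h} = φ² · μ_h`**, and `riemannianMeasure_eq_withDensity_of_conformal_sq_four` — for
  `φ = u²`: **`μ_{u² h} = u⁴ · μ_h`** (Gursky–LeBrun 1999, §3: "Since `dμ_ĝ = u⁴ dμ_g`" for
  `ĝ = u²g`), with the integrated forms `μ_{h₁}(A) = ∫_A √(φ^m) dμ_{h₂}`
  (`riemannianMeasure_apply_of_conformal`).

Everything is proved (from `riemannianMeasure_eq_withDensity_ofReal_of_chartGram`: in every
extended chart the Gram matrices are proportional, `(h₁)_{ij}(y) = φ(p) (h₂)_{ij}(y)` at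
`p = φ_x⁻¹(y)`, so `√det (h₁)_{ij} = √(φ(p)^m) √det (h₂)_{ij}` by `Matrix.det_smul`); no
definitions, no statements of `Prop` type.

## References

* I. Chavel, *Riemannian Geometry: A Modern Introduction*, 2nd ed., CUP 2006, §III.3,
  (III.3.5). [Chavel2006]
* J. M. Lee, T. H. Parker, *The Yamabe problem*, Bull. AMS 17 (1987) 37–91, §1. [LeeParker1987]
* M. J. Gursky, C. LeBrun, Ann. Global Anal. Geom. 17 (1999) 315–328 (arXiv:math/9807055), §3,
  proof of Lemma 4. [GurskyLebrun1999]
-/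

noncomputable section

open Manifold Bundle MeasureTheory Set Filter Function
open scoped ContDiff Topology ENNReal

namespace Literature.Geometry.Lorentzian

section General

variable {H : Type*} [TopologicalSpace H] {n : ℕ∞ω} {m : ℕ}
  {I : ModelWithCorners ℝ (EuclideanSpace ℝ (Fin m)) H}
  {N : Type*} [TopologicalSpace N] [ChartedSpace H N] [IsManifold I 1 N]

/-- **Conformal metrics have proportional Gram matrices**: if `(h₁)_p = φ(p) (h₂)_p` for all `p`
then in the extended chart at `x`, `(h₁)_{ij}(y) = φ(φ_x⁻¹ y) · (h₂)_{ij}(y)`. [folklore] -/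
theorem chartGramMatrix_of_conformal
    (h₁ h₂ : ContMDiffRiemannianMetric I n (EuclideanSpace ℝ (Fin m)) (TangentSpace I : N → Type _))
    {φ : N → ℝ} (hconf : ∀ (p : N) (v w : TangentSpace I p), h₁.inner p v w = φ p * h₂.inner p v w)
    (x : N) (y : EuclideanSpace ℝ (Fin m)) :
    chartGramMatrix h₁ x y = φ ((extChartAt I x).symm y) • chartGramMatrix h₂ x y := by
  refine Matrix.ext fun i j ↦ ?_
  simp only [chartGramMatrix, Matrix.of_apply, Matrix.smul_apply, smul_eq_mul]
  exact hconf _ _ _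

/-- Hence the volume densities are proportional: `√det (h₁)_{ij}(y) = √(φ(p)^m) · √det (h₂)_{ij}(y)`
at `p = φ_x⁻¹(y)`, for `φ ≥ 0` (`det(φ A) = φ^m det A`, `Matrix.det_smul`).
[cite: Chavel2006, §III.3 (III.3.5)] -/
theorem sqrt_det_chartGramMatrix_of_conformal
    (h₁ h₂ : ContMDiffRiemannianMetric I n (EuclideanSpace ℝ (Fin m)) (TangentSpace I : N → Type _))
    {φ : N → ℝ} (hφ : ∀ p, 0 ≤ φ p)
    (hconf : ∀ (p : N) (v w : TangentSpace I p), h₁.inner p v w = φ p * h₂.inner p v w)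
    (x : N) (y : EuclideanSpace ℝ (Fin m)) :
    Real.sqrt (chartGramMatrix h₁ x y).det =
      Real.sqrt (φ ((extChartAt I x).symm y) ^ m) * Real.sqrt (chartGramMatrix h₂ x y).det := by
  rw [chartGramMatrix_of_conformal h₁ h₂ hconf x y, Matrix.det_smul, Fintype.card_fin,
    Real.sqrt_mul (pow_nonneg (hφ _) m)]

variable [T3Space N] [MeasurableSpace N] [BorelSpace N]

/-- **The Riemannian measure of a conformal metric**: on a compact manifold modelled on `ℝ^m`,
if `(h₁)_p = φ(p) (h₂)_p` for all `p` with `φ ≥ 0` measurable, then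
`μ_{h₁} = μ_{h₂}.withDensity (√(φ^m))`, i.e. `dV_{φ h} = φ^{m/2} dV_h` (Chavel 2006, §III.3,
(III.3.5) with `det(φ h_{ij}) = φ^m det h_{ij}`; Lee–Parker 1987, §1: `dV_{g̃} = φ^{2n/(n−2)} dV_g`
for `g̃ = φ^{4/(n−2)} g`). [cite: Chavel2006, §III.3 (III.3.5)] [cite: LeeParker1987, §1] -/
theorem riemannianMeasure_eq_withDensity_of_conformal [CompactSpace N]
    (h₁ h₂ : ContMDiffRiemannianMetric I n (EuclideanSpace ℝ (Fin m)) (TangentSpace I : N → Type _))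
    {φ : N → ℝ} (hφm : Measurable φ) (hφ : ∀ p, 0 ≤ φ p)
    (hconf : ∀ (p : N) (v w : TangentSpace I p), h₁.inner p v w = φ p * h₂.inner p v w) :
    riemannianMeasure h₁ =
      (riemannianMeasure h₂).withDensity (fun p ↦ ENNReal.ofReal (Real.sqrt (φ p ^ m))) :=
  riemannianMeasure_eq_withDensity_ofReal_of_chartGram h₁ h₂
    (Real.continuous_sqrt.measurable.comp (hφm.pow_const m)) (fun _ ↦ Real.sqrt_nonneg _)
    fun x y _ ↦ sqrt_det_chartGramMatrix_of_conformal h₁ h₂ hφ hconf x y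

/-- Integrated form: `μ_{h₁}(A) = ∫_A √(φ^m) dμ_{h₂}` for measurable `A`.
[cite: Chavel2006, §III.3 (III.3.5)] -/
theorem riemannianMeasure_apply_of_conformal [CompactSpace N]
    (h₁ h₂ : ContMDiffRiemannianMetric I n (EuclideanSpace ℝ (Fin m)) (TangentSpace I : N → Type _))
    {φ : N → ℝ} (hφm : Measurable φ) (hφ : ∀ p, 0 ≤ φ p)
    (hconf : ∀ (p : N) (v w : TangentSpace I p), h₁.inner p v w = φ p * h₂.inner p v w)
    {A : Set N} (hA : MeasurableSet A) :
    riemannianMeasure h₁ A = ∫⁻ p in A, ENNReal.ofReal (Real.sqrt (φ p ^ m)) ∂riemannianMeasure h₂ := by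
  rw [riemannianMeasure_eq_withDensity_of_conformal h₁ h₂ hφm hφ hconf, withDensity_apply _ hA]

end General

section Four

variable {H : Type*} [TopologicalSpace H] {n : ℕ∞ω}
  {I : ModelWithCorners ℝ (EuclideanSpace ℝ (Fin 4)) H}
  {N : Type*} [TopologicalSpace N] [ChartedSpace H N] [IsManifold I 1 N] [T3Space N]
  [MeasurableSpace N] [BorelSpace N]

/-- **Dimension four: `dV_{φ h} = φ² dV_h`.** [cite: LeeParker1987, §1] -/
theorem riemannianMeasure_eq_withDensity_of_conformal_four [CompactSpace N]
    (h₁ h₂ : ContMDiffRiemannianMetric I n (EuclideanSpace ℝ (Fin 4)) (TangentSpace I : N → Type _))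
    {φ : N → ℝ} (hφm : Measurable φ) (hφ : ∀ p, 0 ≤ φ p)
    (hconf : ∀ (p : N) (v w : TangentSpace I p), h₁.inner p v w = φ p * h₂.inner p v w) :
    riemannianMeasure h₁ = (riemannianMeasure h₂).withDensity (fun p ↦ ENNReal.ofReal (φ p ^ 2)) := by
  rw [riemannianMeasure_eq_withDensity_of_conformal h₁ h₂ hφm hφ hconf]
  congr 1
  funext p
  rw [show φ p ^ 4 = (φ p ^ 2) ^ 2 by ring, Real.sqrt_sq (pow_nonneg (hφ p) 2)]

/-- **Dimension four, `φ = u²`: `dμ_{u² h} = u⁴ dμ_h`** (Gursky–LeBrun 1999, §3, proof of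
Lemma 4: "Since `dμ_ĝ = u⁴ dμ_g`" for `ĝ = u²g`; here for any real measurable `u`, the
conformal factor being `u² ≥ 0`). [cite: GurskyLebrun1999, §3, proof of Lemma 4] -/
theorem riemannianMeasure_eq_withDensity_of_conformal_sq_four [CompactSpace N]
    (h₁ h₂ : ContMDiffRiemannianMetric I n (EuclideanSpace ℝ (Fin 4)) (TangentSpace I : N → Type _))
    {u : N → ℝ} (hum : Measurable u)
    (hconf : ∀ (p : N) (v w : TangentSpace I p), h₁.inner p v w = u p ^ 2 * h₂.inner p v w) :
    riemannianMeasure h₁ = (riemannianMeasure h₂).withDensity (fun p ↦ ENNReal.ofReal (u p ^ 4)) := by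
  rw [riemannianMeasure_eq_withDensity_of_conformal_four h₁ h₂ (hum.pow_const 2)
    (fun p ↦ sq_nonneg _) hconf]
  congr 1
  funext p
  rw [show (u p ^ 2) ^ 2 = u p ^ 4 by ring]

/-- Integrated form in dimension four with `φ = u²`: `μ_{u²h}(A) = ∫_A u⁴ dμ_h`, in particular
`Vol(N, u²h) = ∫_N u⁴ dμ_h`. [cite: GurskyLebrun1999, §3, proof of Lemma 4] -/
theorem riemannianMeasure_apply_of_conformal_sq_four [CompactSpace N]
    (h₁ h₂ : ContMDiffRiemannianMetric I n (EuclideanSpace ℝ (Fin 4)) (TangentSpace I : N → Type _))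
    {u : N → ℝ} (hum : Measurable u)
    (hconf : ∀ (p : N) (v w : TangentSpace I p), h₁.inner p v w = u p ^ 2 * h₂.inner p v w)
    {A : Set N} (hA : MeasurableSet A) :
    riemannianMeasure h₁ A = ∫⁻ p in A, ENNReal.ofReal (u p ^ 4) ∂riemannianMeasure h₂ := by
  rw [riemannianMeasure_eq_withDensity_of_conformal_sq_four h₁ h₂ hum hconf, withDensity_apply _ hA]

end Four

end Literature.Geometry.Lorentzian

end
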